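import Summits.QuantumFields.YangMills.Theorems.FlatTubeReductionDecimationDefs
import HarnessLib

/-!
# Route `FlatTubeReduction` — DEFINITIONS: windows of contractible slices, the max-run potential, translated link sets
# (extremal part of the W-inj(m=1) proof for crux `PinnedUnitStepEx`, stmt-QuantumFields-27561, stub `stub_smearVarPosGS1`)

Seat ym-line-fcl-p3 g9 (2026-08-28).  Blueprint v2 (evidence on the item), file E1-defs.  Route-posited combinatorial kinematics (no literature):
* `HasWin j R t` — the link set `R ⊆ Edge 3 M` has `t` cyclically consecutive contractible `j`-slices `c, c+1, …, c+t−1` (`IsContr`, `…DecimationDefs`);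
* `mrun j R` — the length of the longest such window (`Nat.findGreatest`, capped at `M`); `maxPot R = Σ_j mrun j R` — the translation-invariant
  ℕ-valued potential maximised over the support of the Hoeffding decomposition (a non-trivial decoder strictly raises it);
* `shiftLinks w R = {(x + w, i) : (x, i) ∈ R}` — translated link sets.
Definitions only; nothing here proves any stub, crux or summit.
-/

set_option autoImplicit false

noncomputable section

namespace Summit.QuantumFields.YangMills.Theorems.FlatTubeReduction.Decimation

open Literature.MathematicalPhysics.QuantumFieldTheory (Site Edge)

/-- `R` has a window of `t` cyclically consecutive contractible `j`-slices.  A route-posited combinatorial predicate, NOT a literature fact. -/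
def HasWin {M : ℕ} (j : Fin 3) (R : Finset (Edge 3 M)) (t : ℕ) : Prop :=
  ∃ c : ZMod M, ∀ i : ℕ, i < t → IsContr j (c + (i : ZMod M)) R

open Classical in
/-- **Max run**: the length of the longest window of contractible `j`-slices of `R` (capped at `M`; `= M` iff every `j`-slice is contractible). [folklore] -/
def mrun {M : ℕ} (j : Fin 3) (R : Finset (Edge 3 M)) : ℕ :=
  Nat.findGreatest (HasWin j R) M

/-- **The max-run potential** `Σ_j mrun_j`. [folklore] -/
def maxPot {M : ℕ} (R : Finset (Edge 3 M)) : ℕ :=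
  ∑ j : Fin 3, mrun j R

/-- The translated link set `R + w = {(x + w, i) : (x, i) ∈ R}`. [folklore] -/
def shiftLinks {M : ℕ} (w : Site 3 M) (R : Finset (Edge 3 M)) : Finset (Edge 3 M) :=
  R.image fun e => (e.1 + w, e.2)

end Summit.QuantumFields.YangMills.Theorems.FlatTubeReduction.Decimation
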